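import Mathlib
import HarnessLib
import Literature.AlgebraicGeometry.Ramification.InertiaNormalSylow
import Literature.AlgebraicGeometry.Resolution.ResolutionOfSingularities
import Literature.AlgebraicGeometry.Resolution.ComponentGluing
import Summits.ResolutionOfSingularities.ResolutionOfSingularities.Theorems.WildQuotientsWildQuotientResolutionStubInertiaLe

/-!
# Composition of equivariant models (round bookkeeping of Phase 0; crux `WildQuotients.WildQuotientResolution`)

Crux stmt-ResolutionOfSingularities-15640 (`WildQuotientResolution`), registered stub
`stub_phaseZeroHighDim`, move-game track (`…PointMove` p810587, `…CurveStep` p810571). The moves of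
a Phase-0 game (and the rounds of the terminating threefold design, memo `PHASE0-DIM3-TERMINATION.md`
§3 / addendum (R8)–(R9)) are composed along towers; this file records the composition of the
clause list of the stub once and for all: an equivariant proper birational model of an
equivariant proper birational model is one (integrality, regularity and the stable affine cover are
properties of the top model), and p-closedness of ALL inertia groups, once reached, is inherited by
every further equivariant model (`I_x ≤ I_{π x}`, ✓`InertiaLe.stub_inertia_le`; subgroups of
p-closed groups are p-closed) — the pattern of ✓`PhaseZeroReduction`.

* `equivariantModel_comp` — composition of the clauses «proper, birational, equivariant».
* `hasNormalSylow_inertia_of_equivariantModel` — p-closed inertia downstairs ⇒ upstairs.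
* `phaseZeroModel_comp` — the stub's full clause list is stable under a further equivariant
  proper birational integral regular model with stable affine cover.

[OURS · crux stmt-ResolutionOfSingularities-15640 · helper toward `stub_phaseZeroHighDim` (round
bookkeeping); folklore, counted 0; AI-level work, weaker than expert review.]
-/

-- single-problem summit: the doubled namespace component `ResolutionOfSingularities` is forced
set_option linter.dupNamespace false

namespace Summit.ResolutionOfSingularities.ResolutionOfSingularities.Theorems.WildQuotientResolution.PhaseZeroModelComp

open CategoryTheory AlgebraicGeometry TopologicalSpace
open Literature.AlgebraicGeometry.Ramification Literature.AlgebraicGeometry.Resolution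

/-- **Composition of equivariant proper birational models.** [folklore] -/
theorem equivariantModel_comp {G : Type} [Group G] {X Y Z : Scheme.{0}}
    (ρX : G →* Aut X) (ρY : G →* Aut Y) (ρZ : G →* Aut Z)
    (π : Y ⟶ X) (π' : Z ⟶ Y) [IsProper π] [IsProper π']
    (hbir : IsBirational π) (hbir' : IsBirational π')
    (hequiv : ∀ g : G, (ρY g).hom ≫ π = π ≫ (ρX g).hom)
    (hequiv' : ∀ g : G, (ρZ g).hom ≫ π' = π' ≫ (ρY g).hom) :
    IsProper (π' ≫ π) ∧ IsBirational (π' ≫ π) ∧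
      ∀ g : G, (ρZ g).hom ≫ (π' ≫ π) = (π' ≫ π) ≫ (ρX g).hom := by
  refine ⟨inferInstance, ComponentGluing.IsBirational.comp hbir' hbir, fun g => ?_⟩
  rw [← Category.assoc, hequiv' g, Category.assoc, hequiv g, Category.assoc]

/-- **p-closed inertia is inherited by equivariant models**: if every inertia group of the action
on `Y` has a normal Sylow `p`-subgroup and `π' : Z → Y` is equivariant, so does every inertia group
on `Z` (`I_z ≤ I_{π' z}`). [folklore] -/
theorem hasNormalSylow_inertia_of_equivariantModel (p : ℕ) [Fact p.Prime] {G : Type} [Group G]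
    [Finite G] {Y Z : Scheme.{0}} (ρY : G →* Aut Y) (ρZ : G →* Aut Z) (π' : Z ⟶ Y)
    (hequiv' : ∀ g : G, (ρZ g).hom ≫ π' = π' ≫ (ρY g).hom)
    (hY : ∀ y : Y, HasNormalSylow p (inertiaSubgroup ρY y)) (z : Z) :
    HasNormalSylow p (inertiaSubgroup ρZ z) :=
  ((hY (π'.base z)).subgroup ((inertiaSubgroup ρZ z).subgroupOf (inertiaSubgroup ρY (π'.base z)))).of_surjective
    (Subgroup.subgroupOfEquivOfLe (InertiaLe.stub_inertia_le ρZ ρY π' hequiv' z)).toMonoidHom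
    (Subgroup.subgroupOfEquivOfLe (InertiaLe.stub_inertia_le ρZ ρY π' hequiv' z)).surjective

/-- **The clause list of `stub_phaseZeroHighDim` is stable under composition**: given an
equivariant proper birational model `π : Y → X` and a further equivariant proper birational model
`π' : Z → Y` with `Z` integral, regular and covered by stable affine opens, the composite
`Z → X` carries all structural clauses; if moreover all inertia groups on `Y` (or on `Z`) are
p-closed, so are all on `Z`. This is the bookkeeping step of every move / round. [folklore] -/
theorem phaseZeroModel_comp (p : ℕ) [Fact p.Prime] {G : Type} [Group G] [Finite G]
    {X Y Z : Scheme.{0}} (ρX : G →* Aut X) (ρY : G →* Aut Y) (ρZ : G →* Aut Z)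
    (π : Y ⟶ X) (π' : Z ⟶ Y) [IsProper π] [IsProper π']
    (hbir : IsBirational π) (hbir' : IsBirational π')
    (hequiv : ∀ g : G, (ρY g).hom ≫ π = π ≫ (ρX g).hom)
    (hequiv' : ∀ g : G, (ρZ g).hom ≫ π' = π' ≫ (ρY g).hom)
    [IsIntegral Z] (hreg : Scheme.IsRegular Z)
    (hcov : ∀ z : Z, ∃ U : Z.Opens, IsAffineOpen U ∧ z ∈ U ∧ ∀ g : G, (ρZ g).hom ⁻¹ᵁ U = U)
    (hNpS : ∀ z : Z, HasNormalSylow p (inertiaSubgroup ρZ z)) :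
    ∃ (Xs : Scheme.{0}) (πs : Xs ⟶ X) (ρs : G →* Aut Xs), IsProper πs ∧ IsBirational πs ∧
      IsIntegral Xs ∧ Scheme.IsRegular Xs ∧ (∀ g : G, (ρs g).hom ≫ πs = πs ≫ (ρX g).hom) ∧
      (∀ x : Xs, HasNormalSylow p (inertiaSubgroup ρs x)) ∧
      ∀ x : Xs, ∃ U : Xs.Opens, IsAffineOpen U ∧ x ∈ U ∧ ∀ g : G, (ρs g).hom ⁻¹ᵁ U = U := by
  obtain ⟨hprop, hbir'', hequiv''⟩ := equivariantModel_comp ρX ρY ρZ π π' hbir hbir' hequiv hequiv'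
  exact ⟨Z, π' ≫ π, ρZ, hprop, hbir'', inferInstance, hreg, hequiv'', hNpS, hcov⟩

end Summit.ResolutionOfSingularities.ResolutionOfSingularities.Theorems.WildQuotientResolution.PhaseZeroModelComp
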